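import Summits.QuantumAdvantage.AdviceFreeQNC0.BlockAdditiveCounts
import HarnessLib

/-!
# Cell qa-qnc0 (rung F-Q1, route RingFrame, crux α, line `product`): block-additive maps — BAD PAIRS
# OF MOVES ARE RARE (qn-p1 TARGET §20.8, ask P6e; PROVER-MEMO-gen4 §2 step (1))

Third file of the prover's τ''-free proof of `Sketch8b.BlockAdditiveFSB`.  A (type-1, type-2) pair of
block moves `(a, b)` on distinct blocks is GOOD if in SOME context both endpoints are `θ`-near the fail
family (then `‖Δ(a) ⊕ Δ(b)‖ < 2θ·2^{L'}`, `cnorm_pair_lt_of_good` in `BlockAdditiveMoves.lean`).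
PROVED here:

* `contexts_subset_of_bad`: for a BAD pair every class-`r`-compatible context has an endpoint in
  `B := FAR_θ ∩ cls r`;
* `card_typedStart_le` / `card_typedEnd_le`: the number of (typed pair, context) configurations whose
  start (resp. landing point) lies in a set `T` is `≤ k²·(2^L/2)²·4^L·#T` (regrouping equivalence +
  the context involution; the landing version by the pattern swap `swapM`, which exchanges the types);
* `card_badPairs_le`: **`#BAD · 2^L ≤ 12·k²·(2^L/2)²·4^L·#B`**, i.e. the bad pairs are an
  `O(#B/2^L)`-fraction of the `≍ k²·4^{2L}` typed pairs — LINEAR in the density of the exceptional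
  class-`r` set, which is what removes the slack `τ''` from the planner's statement.

Remaining steps (memo §2 (2)–(3), for the next prover): Markov ⇒ the exceptional move set `E₁`, a
common good partner for two non-exceptional moves (`k ≥ 21`), the characteristic-2 three-cycle
`Δ(x,y) ⊕ Δ(y,z) ⊕ Δ(z,x) = 0` inside one block, and the landing count via the involution
`(u,i,y) ↦ (u∘(i,y), i, y∘(i,u))`.  WHAT THIS IS NOT: `BlockAdditiveFSB` itself is NOT yet landed;
nothing on FSB/FW at general column degree, nothing on α; no separation claim.
-/

noncomputable section

namespace Summit.QuantumAdvantage.AdviceFreeQNC0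

open Finset
open Literature.Computability.MetaComplexity Literature.Computability.MetaComplexity.Smolensky

namespace BlockAdditive

variable {L L' k : ℕ}

/-! ### Bad pairs are rare -/

section BadPairs

open Classical

/-- Swap the two patterns of a move (the REVERSE move: same increment, opposite type). -/
def swapM (m : Mv L k) : Mv L k := (m.1, m.2.2, m.2.1)

/-- Swapping twice is the identity. -/
theorem swapM_swapM (m : Mv L k) : swapM (swapM m) = m := rfl

/-- The reverse of a type-`1` move is a type-`2` move and conversely. -/
theorem typ_swapM_two {blk : Fin L → Fin k} {m : Mv L k} (h : typ blk m 1) : typ blk (swapM m) 2 := by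
  unfold typ swapM at *; simp only at *; omega

/-- The reverse of a type-`2` move is a type-`1` move. -/
theorem typ_swapM_one {blk : Fin L → Fin k} {m : Mv L k} (h : typ blk m 2) : typ blk (swapM m) 1 := by
  unfold typ swapM at *; simp only at *; omega

/-- The increment of the reverse move is the same. -/
theorem incrM_swapM (G : Fin k → (Fin L → Bool) → (Fin L' → Bool) → Bool) (m : Mv L k) :
    incrM G (swapM m) = incrM G m := by
  funext v; unfold incrM incr swapM; simp only; cases G m.1 m.2.1 v <;> cases G m.1 m.2.2 v <;> rfl

/-- `end2` is `start2` of the reversed moves. -/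
theorem end2_eq_start2_swapM (blk : Fin L → Fin k) (a b : Mv L k) (w : Fin L → Bool) :
    end2 blk a b w = start2 blk (swapM a) (swapM b) w := rfl

/-- The landing configuration of a (type-1, type-2) pair lies in the class of the start. -/
theorem end2_mem_cls_iff (blk : Fin L → Fin k) {a b : Mv L k} (hab : a.1 ≠ b.1)
    (ha : typ blk a 1) (hb : typ blk b 2) (w : Fin L → Bool) (r : ℕ) :
    end2 blk a b w ∈ cls L r ↔ start2 blk a b w ∈ cls L r := by
  unfold cls
  rw [Finset.mem_filter, Finset.mem_filter, end2_eq_start2_swapM,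
    wt_start2 blk (swapM a) (swapM b) hab w, wt_start2 blk a b hab w]
  unfold typ at ha hb
  unfold swapM
  simp only [Finset.mem_univ, true_and]
  omega

/-- For a BAD (type-1, type-2) pair, every class-`r`-compatible context has an endpoint in
`B = FAR_θ ∩ cls r`. -/
theorem contexts_subset_of_bad (blk : Fin L → Fin k) (G : Fin k → (Fin L → Bool) → (Fin L' → Bool) → Bool)
    (D : ℕ) (θ : ℝ) (r : ℕ) {a b : Mv L k} (hab : a.1 ≠ b.1) (ha : typ blk a 1) (hb : typ blk b 2)
    (hbad : ¬ Good blk G D θ a b) :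
    (univ.filter fun w : Fin L → Bool => start2 blk a b w ∈ cls L r) ⊆
      (univ.filter fun w : Fin L → Bool => start2 blk a b w ∈ far D (gammaBA G) θ ∩ cls L r) ∪
      (univ.filter fun w : Fin L → Bool => end2 blk a b w ∈ far D (gammaBA G) θ ∩ cls L r) := by
  intro w hw
  rw [Finset.mem_filter] at hw
  rw [Finset.mem_union, Finset.mem_filter, Finset.mem_filter, Finset.mem_inter, Finset.mem_inter]
  unfold Good at hbad
  push Not at hbad
  by_cases hs : start2 blk a b w ∈ far D (gammaBA G) θ
  · exact Or.inl ⟨Finset.mem_univ _, hs, hw.2⟩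
  · exact Or.inr ⟨Finset.mem_univ _, hbad w hs, (end2_mem_cls_iff blk hab ha hb w r).2 hw.2⟩

/-- The number of patterns of a given type over a fixed pattern is at most half of all. -/
theorem card_typ_le (blk : Fin L → Fin k)
    (hblk : ∀ i : Fin k, 2 ≤ (univ.filter fun j : Fin L => blk j = i).card)
    (i : Fin k) (x : Fin L → Bool) (t : ℕ) :
    2 * ((univ.filter fun y : Fin L → Bool => typ blk (i, x, y) t).card : ℝ) ≤ (2 : ℝ) ^ L := by
  have h := card_filter_wtOn_mod_le (blockOf blk i) (hblk i) (wtOn (blockOf blk i) x + t)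
  have e : (univ.filter fun y : Fin L → Bool => typ blk (i, x, y) t) =
      univ.filter fun u : Fin L → Bool => wtOn (blockOf blk i) u % 3 = (wtOn (blockOf blk i) x + t) % 3 := by
    ext y; simp only [Finset.mem_filter, Finset.mem_univ, true_and, typ]
  rw [e]
  exact h

/-- … and at least a sixth. -/
theorem card_typ_ge (blk : Fin L → Fin k)
    (hblk : ∀ i : Fin k, 2 ≤ (univ.filter fun j : Fin L => blk j = i).card)
    (i : Fin k) (x : Fin L → Bool) (t : ℕ) :
    (2 : ℝ) ^ L ≤ 6 * ((univ.filter fun y : Fin L → Bool => typ blk (i, x, y) t).card : ℝ) := by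
  have h := card_filter_wtOn_mod_ge (blockOf blk i) (hblk i) (wtOn (blockOf blk i) x + t)
  have e : (univ.filter fun y : Fin L → Bool => typ blk (i, x, y) t) =
      univ.filter fun u : Fin L → Bool => wtOn (blockOf blk i) u % 3 = (wtOn (blockOf blk i) x + t) % 3 := by
    ext y; simp only [Finset.mem_filter, Finset.mem_univ, true_and, typ]
  rw [e]
  exact h

/-- Regrouping equivalence `((i,x,y),(j,x₂,y₂),w) ↦ ((i,j),(x,x₂,w),(y,y₂))`. -/
def regroup (L k : ℕ) :
    (Mv L k × Mv L k) × (Fin L → Bool) ≃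
      (Fin k × Fin k) × ((Fin L → Bool) × (Fin L → Bool) × (Fin L → Bool)) ×
        ((Fin L → Bool) × (Fin L → Bool)) where
  toFun q := ((q.1.1.1, q.1.2.1), (q.1.1.2.1, q.1.2.2.1, q.2), (q.1.1.2.2, q.1.2.2.2))
  invFun s := (((s.1.1, s.2.1.1, s.2.2.1), (s.1.2, s.2.1.2.1, s.2.2.2)), s.2.1.2.2)
  left_inv q := by rfl
  right_inv s := by rfl

/-- The regrouped indicator of a typed pair configuration whose start lies in `T`. -/
def pairInd (blk : Fin L → Fin k) (t₁ t₂ : ℕ) (T : Finset (Fin L → Bool)) (ij : Fin k × Fin k)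
    (c : (Fin L → Bool) × (Fin L → Bool) × (Fin L → Bool)) (yy : (Fin L → Bool) × (Fin L → Bool)) : ℝ :=
  if ij.1 ≠ ij.2 ∧ typ blk (ij.1, c.1, yy.1) t₁ ∧ typ blk (ij.2, c.2.1, yy.2) t₂ ∧
      bmove blk (bmove blk c.2.2 ij.1 c.1) ij.2 c.2.1 ∈ T then (1 : ℝ) else 0

/-- For one pair of blocks: `Σ_{c, yy} pairInd ≤ (2^L/2)²·4^L·#T`. -/
theorem sum_pairInd_le (blk : Fin L → Fin k)
    (hblk : ∀ i : Fin k, 2 ≤ (univ.filter fun j : Fin L => blk j = i).card)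
    (t₁ t₂ : ℕ) (T : Finset (Fin L → Bool)) (ij : Fin k × Fin k) :
    (∑ s : ((Fin L → Bool) × (Fin L → Bool) × (Fin L → Bool)) × ((Fin L → Bool) × (Fin L → Bool)),
        pairInd blk t₁ t₂ T ij s.1 s.2) ≤ ((2 : ℝ) ^ L / 2) ^ 2 * ((2 : ℝ) ^ L * (2 : ℝ) ^ L * (T.card : ℝ)) := by
  rw [Fintype.sum_prod_type']
  by_cases hne : ij.1 = ij.2
  · have : ∀ c : (Fin L → Bool) × (Fin L → Bool) × (Fin L → Bool), ∀ yy : (Fin L → Bool) × (Fin L → Bool),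
        pairInd blk t₁ t₂ T ij c yy = 0 := fun c yy => if_neg fun h => h.1 hne
    simp only [this, Finset.sum_const_zero]
    positivity
  · have hinner : ∀ c : (Fin L → Bool) × (Fin L → Bool) × (Fin L → Bool),
        (∑ yy : (Fin L → Bool) × (Fin L → Bool), pairInd blk t₁ t₂ T ij c yy) ≤
          (if bmove blk (bmove blk c.2.2 ij.1 c.1) ij.2 c.2.1 ∈ T then (1 : ℝ) else 0) *
            ((2 : ℝ) ^ L / 2) ^ 2 := by
      intro c
      by_cases hT : bmove blk (bmove blk c.2.2 ij.1 c.1) ij.2 c.2.1 ∈ T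
      · rw [if_pos hT, one_mul]
        calc (∑ yy : (Fin L → Bool) × (Fin L → Bool), pairInd blk t₁ t₂ T ij c yy)
            ≤ ∑ yy : (Fin L → Bool) × (Fin L → Bool),
                (if typ blk (ij.1, c.1, yy.1) t₁ then (1 : ℝ) else 0) *
                  (if typ blk (ij.2, c.2.1, yy.2) t₂ then (1 : ℝ) else 0) := by
              refine Finset.sum_le_sum fun yy _ => ?_
              unfold pairInd
              by_cases h1 : typ blk (ij.1, c.1, yy.1) t₁ <;> by_cases h2 : typ blk (ij.2, c.2.1, yy.2) t₂ <;>
                simp [h1, h2, hne, hT]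
          _ = (∑ y : Fin L → Bool, if typ blk (ij.1, c.1, y) t₁ then (1 : ℝ) else 0) *
                (∑ y₂ : Fin L → Bool, if typ blk (ij.2, c.2.1, y₂) t₂ then (1 : ℝ) else 0) := by
              rw [Fintype.sum_prod_type, Finset.sum_mul]
              refine Finset.sum_congr rfl fun y _ => ?_
              rw [Finset.mul_sum]
          _ ≤ ((2 : ℝ) ^ L / 2) * ((2 : ℝ) ^ L / 2) := by
              rw [Finset.sum_boole, Finset.sum_boole]
              have h1 := card_typ_le blk hblk ij.1 c.1 t₁
              have h2 := card_typ_le blk hblk ij.2 c.2.1 t₂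
              exact mul_le_mul (by linarith) (by linarith) (by positivity) (by positivity)
          _ = ((2 : ℝ) ^ L / 2) ^ 2 := by ring
      · rw [if_neg hT, zero_mul]
        refine le_of_eq (Finset.sum_eq_zero fun yy _ => ?_)
        unfold pairInd
        exact if_neg fun h => hT h.2.2.2
    calc (∑ c : (Fin L → Bool) × (Fin L → Bool) × (Fin L → Bool), ∑ yy : (Fin L → Bool) × (Fin L → Bool),
            pairInd blk t₁ t₂ T ij c yy)
        ≤ ∑ c : (Fin L → Bool) × (Fin L → Bool) × (Fin L → Bool),
            (if bmove blk (bmove blk c.2.2 ij.1 c.1) ij.2 c.2.1 ∈ T then (1 : ℝ) else 0) *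
              ((2 : ℝ) ^ L / 2) ^ 2 := Finset.sum_le_sum fun c _ => hinner c
      _ = ((2 : ℝ) ^ L / 2) ^ 2 * ((2 : ℝ) ^ L * (2 : ℝ) ^ L * (T.card : ℝ)) := by
          rw [← Finset.sum_mul, sum_indicator_start2 blk hne T]; ring

/-- **Counting configurations of typed pairs whose START lies in a set `T`**:
`#{((i,x,y),(j,x₂,y₂),w) : i ≠ j, types t₁ t₂, start ∈ T} ≤ k²·(2^L/2)²·4^L·#T`. -/
theorem card_typedStart_le (blk : Fin L → Fin k)
    (hblk : ∀ i : Fin k, 2 ≤ (univ.filter fun j : Fin L => blk j = i).card)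
    (t₁ t₂ : ℕ) (T : Finset (Fin L → Bool)) :
    ((univ.filter fun q : (Mv L k × Mv L k) × (Fin L → Bool) =>
        q.1.1.1 ≠ q.1.2.1 ∧ typ blk q.1.1 t₁ ∧ typ blk q.1.2 t₂ ∧ start2 blk q.1.1 q.1.2 q.2 ∈ T).card : ℝ) ≤
      (k : ℝ) ^ 2 * (((2 : ℝ) ^ L / 2) ^ 2 * ((2 : ℝ) ^ L * (2 : ℝ) ^ L * (T.card : ℝ))) := by
  have hcard : ((univ.filter fun q : (Mv L k × Mv L k) × (Fin L → Bool) =>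
        q.1.1.1 ≠ q.1.2.1 ∧ typ blk q.1.1 t₁ ∧ typ blk q.1.2 t₂ ∧ start2 blk q.1.1 q.1.2 q.2 ∈ T).card : ℝ) =
      ∑ p : (Fin k × Fin k) × ((Fin L → Bool) × (Fin L → Bool) × (Fin L → Bool)) ×
          ((Fin L → Bool) × (Fin L → Bool)), pairInd blk t₁ t₂ T p.1 p.2.1 p.2.2 := by
    rw [Finset.card_filter]
    push_cast
    exact Fintype.sum_equiv (regroup L k) _ _ fun q => by rfl
  rw [hcard, Fintype.sum_prod_type]
  show (∑ ij : Fin k × Fin k,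
      ∑ s : ((Fin L → Bool) × (Fin L → Bool) × (Fin L → Bool)) × ((Fin L → Bool) × (Fin L → Bool)),
        pairInd blk t₁ t₂ T ij s.1 s.2) ≤ _
  calc (∑ ij : Fin k × Fin k,
      ∑ s : ((Fin L → Bool) × (Fin L → Bool) × (Fin L → Bool)) × ((Fin L → Bool) × (Fin L → Bool)),
        pairInd blk t₁ t₂ T ij s.1 s.2)
      ≤ ∑ _ij : Fin k × Fin k, ((2 : ℝ) ^ L / 2) ^ 2 * ((2 : ℝ) ^ L * (2 : ℝ) ^ L * (T.card : ℝ)) :=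
        Finset.sum_le_sum fun ij _ => sum_pairInd_le blk hblk t₁ t₂ T ij
    _ = (k : ℝ) ^ 2 * (((2 : ℝ) ^ L / 2) ^ 2 * ((2 : ℝ) ^ L * (2 : ℝ) ^ L * (T.card : ℝ))) := by
        rw [Finset.sum_const, Finset.card_univ, Fintype.card_prod, Fintype.card_fin, nsmul_eq_mul]
        push_cast; ring

/-- The pattern-swap involution on pair configurations. -/
def swapPair (L k : ℕ) : (Mv L k × Mv L k) × (Fin L → Bool) ≃ (Mv L k × Mv L k) × (Fin L → Bool) where
  toFun q := ((swapM q.1.1, swapM q.1.2), q.2)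
  invFun q := ((swapM q.1.1, swapM q.1.2), q.2)
  left_inv q := by rfl
  right_inv q := by rfl

/-- **Counting configurations of (type-1, type-2) pairs whose LANDING point lies in `T`** — the same
bound, by pattern swap. -/
theorem card_typedEnd_le (blk : Fin L → Fin k)
    (hblk : ∀ i : Fin k, 2 ≤ (univ.filter fun j : Fin L => blk j = i).card)
    (T : Finset (Fin L → Bool)) :
    ((univ.filter fun q : (Mv L k × Mv L k) × (Fin L → Bool) =>
        q.1.1.1 ≠ q.1.2.1 ∧ typ blk q.1.1 1 ∧ typ blk q.1.2 2 ∧ end2 blk q.1.1 q.1.2 q.2 ∈ T).card : ℝ) ≤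
      (k : ℝ) ^ 2 * (((2 : ℝ) ^ L / 2) ^ 2 * ((2 : ℝ) ^ L * (2 : ℝ) ^ L * (T.card : ℝ))) := by
  have h := card_typedStart_le blk hblk 2 1 T
  have heq : ((univ.filter fun q : (Mv L k × Mv L k) × (Fin L → Bool) =>
        q.1.1.1 ≠ q.1.2.1 ∧ typ blk q.1.1 1 ∧ typ blk q.1.2 2 ∧ end2 blk q.1.1 q.1.2 q.2 ∈ T).card : ℝ) =
      ((univ.filter fun q : (Mv L k × Mv L k) × (Fin L → Bool) =>
        q.1.1.1 ≠ q.1.2.1 ∧ typ blk q.1.1 2 ∧ typ blk q.1.2 1 ∧ start2 blk q.1.1 q.1.2 q.2 ∈ T).card : ℝ) := by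
    rw [Finset.card_filter, Finset.card_filter]
    push_cast
    refine Fintype.sum_equiv (swapPair L k) _ _ fun q => ?_
    refine if_congr ?_ rfl rfl
    show q.1.1.1 ≠ q.1.2.1 ∧ typ blk q.1.1 1 ∧ typ blk q.1.2 2 ∧ end2 blk q.1.1 q.1.2 q.2 ∈ T ↔
      (swapM q.1.1).1 ≠ (swapM q.1.2).1 ∧ typ blk (swapM q.1.1) 2 ∧ typ blk (swapM q.1.2) 1 ∧
        start2 blk (swapM q.1.1) (swapM q.1.2) q.2 ∈ T
    rw [end2_eq_start2_swapM]
    unfold typ swapM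
    simp only
    constructor
    · rintro ⟨h1, h2, h3, h4⟩; exact ⟨h1, by omega, by omega, h4⟩
    · rintro ⟨h1, h2, h3, h4⟩; exact ⟨h1, by omega, by omega, h4⟩
  rw [heq]
  exact h

/-- Sum over a filter of context counts is the count of (pair, context) configurations. -/
theorem sum_filter_card_eq_card (cond : Mv L k × Mv L k → Prop) [DecidablePred cond]
    (P : Mv L k × Mv L k → (Fin L → Bool) → Prop) [∀ p, DecidablePred (P p)] :
    (∑ p ∈ univ.filter cond, ((univ.filter fun w : Fin L → Bool => P p w).card : ℝ)) =
      ((univ.filter fun q : (Mv L k × Mv L k) × (Fin L → Bool) => cond q.1 ∧ P q.1 q.2).card : ℝ) := by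
  have hnat : (univ.filter fun q : (Mv L k × Mv L k) × (Fin L → Bool) => cond q.1 ∧ P q.1 q.2).card =
      ∑ p ∈ univ.filter cond, (univ.filter fun w : Fin L → Bool => P p w).card := by
    rw [card_filter_prod_eq_sum (fun (p : Mv L k × Mv L k) (w : Fin L → Bool) => cond p ∧ P p w),
      Finset.sum_filter]
    refine Finset.sum_congr rfl fun p _ => ?_
    by_cases hc : cond p
    · rw [if_pos hc]
      congr 1
      exact Finset.filter_congr fun w _ => by simp [hc]
    · rw [if_neg hc, Finset.card_eq_zero, Finset.filter_eq_empty_iff]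
      intro w _ h
      exact hc h.1
  rw [hnat]
  push_cast
  rfl

/-- **BAD PAIRS ARE RARE**: the number of bad (type-1, type-2) pairs on distinct blocks is at most
`3·k²·2^{3L}·#B`, `B = FAR_θ ∩ cls r` — i.e. an `O(#B/2^L)` fraction of all typed pairs
(PROVER-MEMO-gen4 §2 step (1), fibre-free form). -/
theorem card_badPairs_le (blk : Fin L → Fin k) (G : Fin k → (Fin L → Bool) → (Fin L' → Bool) → Bool)
    (D : ℕ) (θ : ℝ) (r : ℕ) (hk : 3 ≤ k)
    (hblk : ∀ i : Fin k, 2 ≤ (univ.filter fun j : Fin L => blk j = i).card) :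
    ((univ.filter fun p : Mv L k × Mv L k =>
        p.1.1 ≠ p.2.1 ∧ typ blk p.1 1 ∧ typ blk p.2 2 ∧ ¬ Good blk G D θ p.1 p.2).card : ℝ) * (2 : ℝ) ^ L ≤
      12 * ((k : ℝ) ^ 2 * (((2 : ℝ) ^ L / 2) ^ 2 *
        ((2 : ℝ) ^ L * (2 : ℝ) ^ L * ((far D (gammaBA G) θ ∩ cls L r).card : ℝ)))) := by
  set B := far D (gammaBA G) θ ∩ cls L r with hB
  set BADP := univ.filter fun p : Mv L k × Mv L k =>
      p.1.1 ≠ p.2.1 ∧ typ blk p.1 1 ∧ typ blk p.2 2 ∧ ¬ Good blk G D θ p.1 p.2 with hBADP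
  set COND := univ.filter fun p : Mv L k × Mv L k => p.1.1 ≠ p.2.1 ∧ typ blk p.1 1 ∧ typ blk p.2 2
    with hCOND
  -- per bad pair: 2^L ≤ 6 (#{w : start ∈ B} + #{w : end ∈ B})
  have hper : ∀ p ∈ BADP, (2 : ℝ) ^ L ≤
      6 * (((univ.filter fun w : Fin L → Bool => start2 blk p.1 p.2 w ∈ B).card : ℝ) +
        ((univ.filter fun w : Fin L → Bool => end2 blk p.1 p.2 w ∈ B).card : ℝ)) := by
    intro p hp
    rw [hBADP, Finset.mem_filter] at hp
    obtain ⟨_, hab, ha, hb, hbad⟩ := hp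
    have h1 := two_pow_le_six_mul_card_contexts blk hk hblk p.1 p.2 hab r
    have h2 := Finset.card_le_card (contexts_subset_of_bad blk G D θ r hab ha hb hbad)
    have h3 := Finset.card_union_le
      (univ.filter fun w : Fin L → Bool => start2 blk p.1 p.2 w ∈ far D (gammaBA G) θ ∩ cls L r)
      (univ.filter fun w : Fin L → Bool => end2 blk p.1 p.2 w ∈ far D (gammaBA G) θ ∩ cls L r)
    have h4 : (((univ.filter fun w : Fin L → Bool => start2 blk p.1 p.2 w ∈ cls L r).card : ℕ) : ℝ) ≤
        ((univ.filter fun w : Fin L → Bool => start2 blk p.1 p.2 w ∈ B).card : ℝ) +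
          ((univ.filter fun w : Fin L → Bool => end2 blk p.1 p.2 w ∈ B).card : ℝ) := by
      rw [hB]; exact_mod_cast h2.trans h3
    linarith
  have hsum : (BADP.card : ℝ) * (2 : ℝ) ^ L ≤
      6 * ((∑ p ∈ BADP, ((univ.filter fun w : Fin L → Bool => start2 blk p.1 p.2 w ∈ B).card : ℝ)) +
        ∑ p ∈ BADP, ((univ.filter fun w : Fin L → Bool => end2 blk p.1 p.2 w ∈ B).card : ℝ)) := by
    rw [← Finset.sum_add_distrib, Finset.mul_sum]
    have : (BADP.card : ℝ) * (2 : ℝ) ^ L = ∑ _p ∈ BADP, (2 : ℝ) ^ L := by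
      rw [Finset.sum_const, nsmul_eq_mul]
    rw [this]
    exact Finset.sum_le_sum hper
  have hsub : BADP ⊆ COND := by
    intro p hp
    rw [hBADP, Finset.mem_filter] at hp
    rw [hCOND, Finset.mem_filter]
    exact ⟨hp.1, hp.2.1, hp.2.2.1, hp.2.2.2.1⟩
  have hS1 : (∑ p ∈ BADP, ((univ.filter fun w : Fin L → Bool => start2 blk p.1 p.2 w ∈ B).card : ℝ)) ≤
      (k : ℝ) ^ 2 * (((2 : ℝ) ^ L / 2) ^ 2 * ((2 : ℝ) ^ L * (2 : ℝ) ^ L * (B.card : ℝ))) := by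
    calc (∑ p ∈ BADP, ((univ.filter fun w : Fin L → Bool => start2 blk p.1 p.2 w ∈ B).card : ℝ))
        ≤ ∑ p ∈ COND, ((univ.filter fun w : Fin L → Bool => start2 blk p.1 p.2 w ∈ B).card : ℝ) :=
          Finset.sum_le_sum_of_subset_of_nonneg hsub fun _ _ _ => by positivity
      _ = ((univ.filter fun q : (Mv L k × Mv L k) × (Fin L → Bool) =>
            (q.1.1.1 ≠ q.1.2.1 ∧ typ blk q.1.1 1 ∧ typ blk q.1.2 2) ∧ start2 blk q.1.1 q.1.2 q.2 ∈ B).card : ℝ) := by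
          rw [hCOND]
          exact sum_filter_card_eq_card (fun p : Mv L k × Mv L k => p.1.1 ≠ p.2.1 ∧ typ blk p.1 1 ∧ typ blk p.2 2)
            (fun p w => start2 blk p.1 p.2 w ∈ B)
      _ = ((univ.filter fun q : (Mv L k × Mv L k) × (Fin L → Bool) =>
            q.1.1.1 ≠ q.1.2.1 ∧ typ blk q.1.1 1 ∧ typ blk q.1.2 2 ∧ start2 blk q.1.1 q.1.2 q.2 ∈ B).card : ℝ) := by
          congr 2
          refine Finset.filter_congr fun q _ => ?_
          tauto
      _ ≤ _ := card_typedStart_le blk hblk 1 2 B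
  have hS2 : (∑ p ∈ BADP, ((univ.filter fun w : Fin L → Bool => end2 blk p.1 p.2 w ∈ B).card : ℝ)) ≤
      (k : ℝ) ^ 2 * (((2 : ℝ) ^ L / 2) ^ 2 * ((2 : ℝ) ^ L * (2 : ℝ) ^ L * (B.card : ℝ))) := by
    calc (∑ p ∈ BADP, ((univ.filter fun w : Fin L → Bool => end2 blk p.1 p.2 w ∈ B).card : ℝ))
        ≤ ∑ p ∈ COND, ((univ.filter fun w : Fin L → Bool => end2 blk p.1 p.2 w ∈ B).card : ℝ) :=
          Finset.sum_le_sum_of_subset_of_nonneg hsub fun _ _ _ => by positivity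
      _ = ((univ.filter fun q : (Mv L k × Mv L k) × (Fin L → Bool) =>
            (q.1.1.1 ≠ q.1.2.1 ∧ typ blk q.1.1 1 ∧ typ blk q.1.2 2) ∧ end2 blk q.1.1 q.1.2 q.2 ∈ B).card : ℝ) := by
          rw [hCOND]
          exact sum_filter_card_eq_card (fun p : Mv L k × Mv L k => p.1.1 ≠ p.2.1 ∧ typ blk p.1 1 ∧ typ blk p.2 2)
            (fun p w => end2 blk p.1 p.2 w ∈ B)
      _ = ((univ.filter fun q : (Mv L k × Mv L k) × (Fin L → Bool) =>
            q.1.1.1 ≠ q.1.2.1 ∧ typ blk q.1.1 1 ∧ typ blk q.1.2 2 ∧ end2 blk q.1.1 q.1.2 q.2 ∈ B).card : ℝ) := by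
          congr 2
          refine Finset.filter_congr fun q _ => ?_
          tauto
      _ ≤ _ := card_typedEnd_le blk hblk B
  linarith

end BadPairs

end BlockAdditive

end Summit.QuantumAdvantage.AdviceFreeQNC0

end
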